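import Summits.QuantumFields.BalabanUV.Beta.EriceRemainderEnclosureHistoryAutonomyComparisonAgeCompositionStaticEndFlow

/-!
# EriceRemainderEnclosureHistoryAutonomyComparisonAgeCompositionStaticEndSharp — (E81j) THE STATIC END WITH THE SHARP AGGREGATE FAMILY: (E81h)'s family
# (S-c) (tail sums of the aggregate kernel against the per-pin Harnack growth of its own surplus) FAILS along flows with a saturated young age above an
# old one (`g72/numerics/m20.py`: ratios 1.0002–1.0165 at the pin), because the lag-one Harnack step books the lag-zero reads as lost although the
# ENTERING lag of every age replaces them; crediting the entering lags below the edge (`per_pin_growth_sharp`: `(1 − Σ_k(κ^k_{m,0} − κ^k_{m+1,y_k−1}))·v_{m+1}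
# ≤ (1 + Σ_kθ_k(m;1)β_k)·v_m` for a surplus non-decreasing below its edge) gives the edge-indexed family (S-c♯), which HOLDS along every flow tested
# (`m21.py`: worst 0.9905), and the same END

Cell `pub-balaban`, β-function sub-cell, BINDER row D4 «RemainderConst leaves for Bałaban's split» (`HOME/BINDER-OWNERS.md`; owner lineage `b2b-balaban-beta-an4`;
this file by co-owner #2 lineage `b2b-balaban-beta-d4-p2`, generation 72), β-FLOW TEAM duty (1), FREEZE (0) honoured (def-free; imports (E81i)
`…StaticEndFlow`; the induction is (E81h)'s with the aggregate family replaced; uses (E71a)–(E81h) and (E81g) `per_pin_growth_sharp` BY NAME; nothing restated).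

HONEST FRAMING (page 1, verbatim and binding).  *"Discharging BetaPertH makes Bałaban's UV stability UNCONDITIONAL — a real constructive-QFT result; it is
NOT the continuum limit and NOT the Clay problem."*  THIS FILE DISCHARGES NOTHING OF THE KIND.  Elementary real algebra about ABSTRACT triangular renewal
systems — hypotheses of a census, not facts; the age profile of Bałaban's (1.22) limit functional is NOT PRINTED ([I] p. 298; GAPS G-t4-U2-1∕-2) and NOT
asserted.  Row D4 class UNCHANGED (critical-path width 0; instance 0∕1; D4 DISCHARGE NO DATE).  HONEST DEPENDENCY: continuum YM on T⁴ ⇐ BetaPertH ∧ nine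
spine estimates (0/9 proved); BetaPertH ⇐ (D1) ∧ (D4) ∧ CAP+tail; G-an2-4 gates asym, D1 and NE2/3/4.

THE POINT (census sense (α); route (N); README `g72/e81/README.md` §5∕§6).  (E81h)∕(E81i) are correct but their hypothesis (S-c) is violated along some flows
(saturated young age, old age `k`, pin `0`, tail `L' = y`): the old kernel rows would have to absorb the young-driven growth of the full surplus PLUS the
lag-zero reads that (E71c) `harnack_step` books as lost.  (E81g, appended) **`per_pin_growth_sharp`**: if the surplus `v` of the ages `> i` is known to be non-decreasing
from the depth `m+1` to `m+1+y_k` for the marked ages (`s_k = 1`; in the induction: entering target below the edge), then `(1 − Σ_{k∈(i,n]}(KL k m 0 −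
s_k·KL k (m+1) (y_k−1)))·v (m+1) ≤ (1 + Σ_{k∈(i,n]} θ k m 1·β_k)·v m` — the drop of age `k` one pin deeper keeps the persisting part AND gains the entering
read.  HERE: **`nonneg_and_drop_ratio_all_ages_sharp`** ∕ **`nonneg_of_sharp_static_families`**: (E81h) with (S-c) replaced by the EDGE-INDEXED family (S-c♯)
(growth `HgS (i−1) j m = (1 + V1)∕(1 − Σ_k(KL k m 0 − [m+1+y_k ≤ j]·KL k (m+1)(y_k−1)))`; full windows `m+1+N ≤ j`, partial windows `j = m+1+L`).  NUMERICS
(`g72/numerics/m21.py`; {1 sat, 16}, {1 sat, 30}, {2 sat, 24}, {1,2,20}, towers, pairs, {3 sat, 30}): old (S-c) worst 1.0002–1.0165 (false), (S-c♯) worst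
0.9905, (M1) direct 0 violations; (S-a) ≤ 0.990 and (S-b) ≤ 0.993 unchanged (`m19`∕`m20`).  NOT CLAIMED: (S-a), (S-b), (S-c♯) for the flow; anything printed.

WHAT IS PROVED ([folklore]; 0 `def`, 0 sorry).  **`nonneg_and_drop_ratio_all_ages_sharp`**, **`nonneg_of_sharp_static_families`**.
-/
noncomputable section
open Finset

namespace Summit.QuantumFields.BalabanUV.Beta.EriceRemainderEnclosureHistoryAutonomyComparisonAgeCompositionStaticEndSharp

open Summit.QuantumFields.BalabanUV.Beta.EriceRemainderEnclosureHistoryAutonomyComparisonAgeComposition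
open Summit.QuantumFields.BalabanUV.Beta.EriceRemainderEnclosureHistoryAutonomyComparisonAgeCompositionInduction
open Summit.QuantumFields.BalabanUV.Beta.EriceRemainderEnclosureHistoryAutonomyComparisonAgeCompositionSandwich
open Summit.QuantumFields.BalabanUV.Beta.EriceRemainderEnclosureHistoryAutonomyComparisonAgeCompositionChainWiring
open Summit.QuantumFields.BalabanUV.Beta.EriceRemainderEnclosureHistoryAutonomyComparisonAgeCompositionChainWiringTerms
open Summit.QuantumFields.BalabanUV.Beta.EriceRemainderEnclosureHistoryAutonomyComparisonAgeCompositionReadDecay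
open Summit.QuantumFields.BalabanUV.Beta.EriceRemainderEnclosureHistoryAutonomyComparisonAgeCompositionReadMonotone
open Summit.QuantumFields.BalabanUV.Beta.EriceRemainderEnclosureHistoryAutonomyComparisonAgeCompositionTailSums
open Summit.QuantumFields.BalabanUV.Beta.EriceRemainderEnclosureHistoryAutonomyComparisonAgeCompositionStaticWiring
open Summit.QuantumFields.BalabanUV.Beta.EriceRemainderEnclosureHistoryAutonomyComparisonAgeCompositionStaticEnd

variable {N n : ℕ} {KL KA : ℕ → ℕ → ℕ → ℝ} {RL RA SL SA : ℕ → (ℕ → ℝ) → ℕ → ℝ} {y : ℕ → ℕ} {θ : ℕ → ℕ → ℕ → ℝ}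

/-! ## The induction and the END with the sharp aggregate family -/

/-- **THE JOINT INDUCTION WITH (M1) CARRIED — SHARP AGGREGATE FAMILY.**  As (E81h) `nonneg_and_drop_ratio_all_ages_static`, with the aggregate tail-sum family
(S-c) replaced by the EDGE-INDEXED family (S-c♯) whose growth factors `HgS (i−1) j` credit the entering lags below the edge `j` (`per_pin_growth_sharp`).
[folklore] -/
theorem nonneg_and_drop_ratio_all_ages_sharp
    (hKL : ∀ i m l, 0 ≤ KL i m l) (hKLN : ∀ i m l, N ≤ l → KL i m l = 0) (hKLy : ∀ i m l, y i ≤ l → KL i m l = 0)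
    (hRL : ∀ i v m, RL i v m = ∑ l ∈ range N, KL i m l * v (m + 1 + l))
    (hRA : ∀ i v m, RA i v m = ∑ l ∈ range N, KA i m l * v (m + 1 + l))
    (hKA : ∀ i m l, KA i m l = KL i m l + KA (i + 1) m l) (hKAtop : ∀ m l, KA (n + 1) m l = 0)
    (hSL : ∀ i (w : ℕ → ℝ), (∀ m, N < m → w m = 0) → (∀ m, N < m → SL i w m = 0) ∧ ∀ m, SL i w m = w m - RL i (SL i w) m)
    (hSA : ∀ i (w : ℕ → ℝ), (∀ m, N < m → w m = 0) → (∀ m, N < m → SA i w m = 0) ∧ ∀ m, SA i w m = w m - RA i (SA i w) m)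
    (hy : ∀ i, 1 ≤ i → i ≤ n → 1 ≤ y i ∧ y i ≤ N)
    (hθ0 : ∀ k m l, 0 ≤ θ k m l) (hpers : ∀ k m l i', (1 - θ k m l) * KL k m (i' + l) ≤ KL k (m + l) i')
    (hθmono : ∀ k m l l', l ≤ l' → θ k m l ≤ θ k m l')
    {ρ : ℕ → ℕ → ℝ} {β : ℕ → ℕ → ℕ → ℝ}
    (hρ : ∀ i m, 1 ≤ i → i ≤ n → ρ i m = (∑ l ∈ range N, KL i m l) * (1 + ∑ k ∈ Ioc i n, θ k m (y i) * β (i + 1) m k) /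
      (1 - ∑ k ∈ Ioc i n, ∑ l ∈ range (y i), KL k m l))
    (hβnew : ∀ i m, 1 ≤ i → i ≤ n → β i m i = ρ i m / (1 - ρ i m))
    (hβold : ∀ i m k, 1 ≤ i → i < k → k ≤ n → β i m k = β (i + 1) m k / (1 - ρ i m))
    (hΩ1 : ∀ i m, 1 ≤ i → i ≤ n → ∑ k ∈ Ioc i n, ∑ l ∈ range (y i), KL k m l < 1)
    (hclose : ∀ i m, 1 ≤ i → i ≤ n → ρ i m < 1)
    (hcumL : ∀ k, 1 ≤ k → k ≤ n → ∀ m L, ∑ l ∈ range (L + 1), KL k (m + 1) l ≤ ∑ l ∈ range (L + 2), KL k m l)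
    (hΩ0 : ∀ i m, i ≤ n → ∑ k ∈ Ioc i n, KL k m 0 < 1)
    {Hg : ℕ → ℕ → ℝ} (hH : ∀ i m, Hg i m = (1 + ∑ k ∈ Ioc i n, θ k m 1 * β (i + 1) m k) / (1 - ∑ k ∈ Ioc i n, KL k m 0))
    {M : ℕ → ℕ → ℝ} (hM : ∀ i m, M i m = KL i m 0 + ∑ l ∈ range (N - 1), max (KL i m (l + 1) - KL i (m + 1) l) 0)
    (hSb : ∀ i m, 1 ≤ i → i ≤ n → ∀ L', L' < y i →
      (1 + M i m) * ∑ l ∈ Ico L' (y i), Hg i (m + 1 + l) * KL i (m + 1) l ≤ ∑ l ∈ Ico L' (y i), KL i m l)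
    (hSbp : ∀ i m, 1 ≤ i → i ≤ n → ∀ L, L < y i → ∀ L', L' ≤ L →
      (1 + M i m) * ∑ l ∈ Ico L' L, Hg i (m + 1 + l) * KL i (m + 1) l ≤ ∑ l ∈ Ico L' (L + 1), KL i m l)
    {HgS : ℕ → ℕ → ℕ → ℝ} (hHS : ∀ i j m, HgS i j m = (1 + ∑ k ∈ Ioc i n, θ k m 1 * β (i + 1) m k) /
      (1 - ∑ k ∈ Ioc i n, (KL k m 0 - if m + 1 + y k ≤ j then KL k (m + 1) (y k - 1) else 0)))
    (hSc : ∀ i m j, 1 ≤ i → i ≤ n → m + 1 + N ≤ j → ∀ L', L' < N →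
      ∑ l ∈ Ico L' N, HgS (i - 1) j (m + 1 + l) * KA i (m + 1) l ≤ ∑ l ∈ Ico L' N, KA i m l)
    (hScp : ∀ i m L, 1 ≤ i → i ≤ n → L < N → ∀ L', L' ≤ L →
      ∑ l ∈ Ico L' L, HgS (i - 1) (m + 1 + L) (m + 1 + l) * KA i (m + 1) l ≤ ∑ l ∈ Ico L' (L + 1), KA i m l) :
    ∀ i, 1 ≤ i → i ≤ n + 1 →
      (∀ m k, i ≤ k → k ≤ n → 0 ≤ β i m k) ∧
      (∀ w : ℕ → ℝ, (∀ m, 0 ≤ w m) → (∀ m, w (m + 1) ≤ w m) → (∀ m, N < m → w m = 0) →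
        (∀ m, 0 ≤ SA i w m) ∧ (∀ m k, i ≤ k → k ≤ n → RL k (SA i w) m ≤ β i m k * SA i w m)) ∧
      (∀ j, j ≤ N → ∀ m, m < j → SA i (fun m => if m ≤ j then (1:ℝ) else 0) m ≤ SA i (fun m => if m ≤ j then (1:ℝ) else 0) (m + 1)) := by
  suffices h : ∀ d i, i + d = n + 1 → 1 ≤ i →
      (∀ m k, i ≤ k → k ≤ n → 0 ≤ β i m k) ∧
      (∀ w : ℕ → ℝ, (∀ m, 0 ≤ w m) → (∀ m, w (m + 1) ≤ w m) → (∀ m, N < m → w m = 0) →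
        (∀ m, 0 ≤ SA i w m) ∧ (∀ m k, i ≤ k → k ≤ n → RL k (SA i w) m ≤ β i m k * SA i w m)) ∧
      (∀ j, j ≤ N → ∀ m, m < j → SA i (fun m => if m ≤ j then (1:ℝ) else 0) m ≤ SA i (fun m => if m ≤ j then (1:ℝ) else 0) (m + 1)) from
    fun i hi hin => h (n + 1 - i) i (by omega) hi
  -- the support of the surplus of a truncation, and the per-pin growth from drop ratios (both levels)
  have hsupp : ∀ i j, j ≤ N → ∀ m, j < m → SA i (fun m => if m ≤ j then (1:ℝ) else 0) m = 0 := by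
    intro i j hj m hm
    have het := (truncation_admissible (N := N) hj).2.2
    exact sol_eq_zero_of_tail (hRA i) (hSA i _ het).1 (hSA i _ het).2 (c := N - j)
      (fun m' hm' => by exact if_neg (by omega)) m (by omega)
  have hN1 : 1 ≤ n → 1 ≤ N := fun hn => (hy 1 le_rfl hn).2.trans' (hy 1 le_rfl hn).1
  intro d
  induction d with
  | zero =>
    intro i hi _
    have : i = n + 1 := by omega
    subst this
    refine ⟨fun m k hk hkn => by omega, fun w hw0 _ hwt => ⟨fun m => ?_, fun m k hk hkn => by omega⟩, fun j hj m hmj => ?_⟩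
    · rw [aggregate_sol_top hRA hKAtop hSA hwt m]; exact hw0 m
    · have het := (truncation_admissible (N := N) hj).2.2
      rw [aggregate_sol_top hRA hKAtop hSA het m, aggregate_sol_top hRA hKAtop hSA het (m + 1)]
      rw [if_pos (by omega), if_pos (by omega)]
  | succ d ih =>
    intro i hi hi1
    have hin : i ≤ n := by omega
    obtain ⟨hBN, hIH, hM1⟩ := ih (i + 1) (by omega) (by omega)
    obtain ⟨hy1, hyN⟩ := hy i hi1 hin
    have hx0 : ∀ m, 0 ≤ ∑ l ∈ range N, KL i m l := fun m => sum_nonneg fun l _ => hKL i m l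
    have hV0 : ∀ m, 0 ≤ ∑ k ∈ Ioc i n, θ k m (y i) * β (i + 1) m k := fun m =>
      sum_nonneg fun k hk => mul_nonneg (hθ0 k m _) (hBN m k (by have := (mem_Ioc.mp hk).1; omega) (mem_Ioc.mp hk).2)
    have hρ0 : ∀ m, 0 ≤ ρ i m := fun m => by
      rw [hρ i m hi1 hin]
      exact div_nonneg (mul_nonneg (hx0 m) (by linarith [hV0 m])) (by linarith [hΩ1 i m hi1 hin])
    have hρ1 : ∀ m, ρ i m < 1 := fun m => hclose i m hi1 hin
    -- (A) KEY_i WITH THE RATIO ρ_i(m)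
    have hkey : ∀ w : ℕ → ℝ, (∀ m, 0 ≤ w m) → (∀ m, w (m + 1) ≤ w m) → (∀ m, N < m → w m = 0) →
        ∀ m, RL i (SA (i + 1) w) m ≤ ρ i m * SA (i + 1) w m := by
      intro w hw0 hwa hwt m
      obtain ⟨hP, hDR⟩ := hIH w hw0 hwa hwt
      have h := (key_ratio_of_drop_ratios hKL hKLN hKLy hRL hRA hKA hKAtop hθ0 hpers hθmono hin hy1 hyN hP hwa
        (fun m' => (hSA (i + 1) w hwt).2 m') (m := m) (β := fun k => β (i + 1) m k)
        (fun k hk hkn => hDR m k (by omega) hkn) (hΩ1 i m hi1 hin)).2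
      rw [hρ i m hi1 hin]
      exact h
    have hKEY : ∀ w : ℕ → ℝ, (∀ m, 0 ≤ w m) → (∀ m, w (m + 1) ≤ w m) → (∀ m, N < m → w m = 0) →
        ∀ m, RL i (SA (i + 1) w) m ≤ SA (i + 1) w m := by
      intro w hw0 hwa hwt m
      have h1 := hkey w hw0 hwa hwt m
      have h2 := (hIH w hw0 hwa hwt).1 m
      nlinarith [hρ1 m]
    -- the old aggregate kernel: signs, horizon, cumulative domination
    have hKA0 : ∀ m l, 0 ≤ KA (i + 1) m l := fun m l => by
      rw [aggregate_eq_sum hKA hKAtop (by omega : i + 1 ≤ n + 1)]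
      exact sum_nonneg fun k _ => hKL k m l
    have hKAN : ∀ m l, N ≤ l → KA (i + 1) m l = 0 := fun m l hl => by
      rw [aggregate_eq_sum hKA hKAtop (by omega : i + 1 ≤ n + 1)]
      exact sum_eq_zero fun k _ => hKLN k m l hl
    have hcumA := cum_dom_aggregate hKA hKAtop hcumL (i := i + 1) (by omega) (by omega)
    -- the per-pin growth of the old surplus (level i+1) from its drop ratios
    have hΩ0i := fun m => hΩ0 i m hin
    have hgrow : ∀ w : ℕ → ℝ, (∀ m, 0 ≤ w m) → (∀ m, w (m + 1) ≤ w m) → (∀ m, N < m → w m = 0) →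
        ∀ m, SA (i + 1) w (m + 1) ≤ Hg i m * SA (i + 1) w m := by
      intro w hw0 hwa hwt m
      obtain ⟨hP, hDR⟩ := hIH w hw0 hwa hwt
      have h := per_pin_growth_of_drop_ratios hKL hKLN (hN1 (by omega)) hRL hRA hKA hKAtop hθ0 hpers hin hP hwa
        (fun m' => (hSA (i + 1) w hwt).2 m') (m := m) (β := fun k => β (i + 1) m k) (fun k hk hkn => hDR m k (by omega) hkn)
      rw [hH, div_mul_eq_mul_div, le_div_iff₀ (by linarith [hΩ0i m])]
      linarith
    -- (B) MONO″_i: for truncations from (M1)_{i+1}, growth and (S-b); for all admissible inputs by linearity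
    have hM0 : ∀ m, 0 ≤ M i m := fun m => by rw [hM]; exact add_nonneg (hKL i m 0) (sum_nonneg fun l _ => le_max_right _ _)
    have hMONO2 : ∀ w : ℕ → ℝ, (∀ m, 0 ≤ w m) → (∀ m, w (m + 1) ≤ w m) → (∀ m, N < m → w m = 0) →
        ∀ m, RL i (SL i (SA (i + 1) w)) (m + 1) ≤ RL i (SL i (SA (i + 1) w)) m := by
      intro w hw0 hwa hwt
      -- linearity of the composite w ↦ RL i (SL i (SA (i+1) w))
      have hlin : ∀ (s : Finset ℕ) (a : ℕ → ℝ) (u : ℕ → ℕ → ℝ), (∀ j ∈ s, ∀ m, N < m → u j m = 0) →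
          ∀ m, (fun (w : ℕ → ℝ) m => RL i (SL i (SA (i + 1) w)) m) (fun m => ∑ j ∈ s, a j * u j m) m =
            ∑ j ∈ s, a j * (fun (w : ℕ → ℝ) m => RL i (SL i (SA (i + 1) w)) m) (u j) m := by
        intro s a u hu m
        have e1 : SA (i + 1) (fun m => ∑ j ∈ s, a j * u j m) = fun m => ∑ j ∈ s, a j * SA (i + 1) (u j) m :=
          funext (sol_lincomb (hRA (i + 1)) (hSA (i + 1)) s a hu)
        have hu' : ∀ j ∈ s, ∀ m, N < m → SA (i + 1) (u j) m = 0 := fun j hj => (hSA (i + 1) (u j) (hu j hj)).1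
        have e2 : SL i (fun m => ∑ j ∈ s, a j * SA (i + 1) (u j) m) = fun m => ∑ j ∈ s, a j * SL i (SA (i + 1) (u j)) m :=
          funext (sol_lincomb (hRL i) (hSL i) s a hu')
        beta_reduce
        rw [e1, e2, read_lincomb (hRL i)]
      -- truncations: (E81f) read decay + (E81a)
      have htr : ∀ j, j ≤ N → ∀ m, (fun (w : ℕ → ℝ) m => RL i (SL i (SA (i + 1) w)) m) (fun m => if m ≤ j then (1:ℝ) else 0) (m + 1) ≤
          (fun (w : ℕ → ℝ) m => RL i (SL i (SA (i + 1) w)) m) (fun m => if m ≤ j then (1:ℝ) else 0) m := by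
        intro j hj m
        beta_reduce
        obtain ⟨he0, hea, het⟩ := truncation_admissible (N := N) hj
        have hvt := (hSA (i + 1) _ het).1
        have hv0 := (hIH _ he0 hea het).1
        have hcrit : ∀ n', M i n' * RL i (SA (i + 1) (fun m => if m ≤ j then (1:ℝ) else 0)) (n' + 1) ≤
            RL i (SA (i + 1) (fun m => if m ≤ j then (1:ℝ) else 0)) n' - RL i (SA (i + 1) (fun m => if m ≤ j then (1:ℝ) else 0)) (n' + 1) :=
          fun n' => read_decay_of_tail_sums (hRL i) (hKL i) (fun m l hl => hKLy i m l hl) hy1 hyN hv0 (hsupp (i + 1) j hj) (hM1 j hj)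
            (H := Hg i) (fun m _ => hgrow _ he0 hea het m) (hM0 n')
            (fun _ L' hL' => hSb i n' hi1 hin L' hL') (fun L _ hLy L' hL' => hSbp i n' hi1 hin L hLy L' hL')
        have htv := sol_nonneg_le_of_supersol (hRL i) (hKL i) hv0 (hKEY _ he0 hea het) (hSL i _ hvt).1 (hSL i _ hvt).2
        exact young_drops_antitone_of_read_decay hRL hKL hSL (hM i) hv0 hvt (hKEY _ he0 hea het)
          (fun m => (drops_mem (hRL i) (hKL i) htv m).2) hcrit m
      exact antitone_of_truncations (D := fun (w : ℕ → ℝ) m => RL i (SL i (SA (i + 1) w)) m) hlin htr hwa hwt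
    -- MONO_i in full (signs from KEY_i, MONOa from (S-a)) and MONO′_i through the Neumann terms
    have hMONO : ∀ w : ℕ → ℝ, (∀ m, 0 ≤ w m) → (∀ m, w (m + 1) ≤ w m) → (∀ m, N < m → w m = 0) →
        (∀ m, 0 ≤ RA (i + 1) (RL i (SL i (SA (i + 1) w))) m) ∧
        (∀ m, RA (i + 1) (RL i (SL i (SA (i + 1) w))) (m + 1) ≤ RA (i + 1) (RL i (SL i (SA (i + 1) w))) m) := by
      intro w hw0 hwa hwt
      have hvt := (hSA (i + 1) w hwt).1
      have ht := sol_nonneg_le_of_supersol (hRL i) (hKL i) (hIH w hw0 hwa hwt).1 (hKEY w hw0 hwa hwt) (hSL i _ hvt).1 (hSL i _ hvt).2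
      have hd0 : ∀ m, 0 ≤ RL i (SL i (SA (i + 1) w)) m := fun m => read_nonneg (hRL i) (hKL i) (fun m' _ => (ht m').1)
      exact ⟨fun m => read_nonneg (hRA (i + 1)) hKA0 (fun m' _ => hd0 m'),
        read_antitone_of_cum_dom (hRA (i + 1)) hKA0 hKAN hcumA hd0 (hMONO2 w hw0 hwa hwt)⟩
    have hMONO' : ∀ w : ℕ → ℝ, (∀ m, 0 ≤ w m) → (∀ m, w (m + 1) ≤ w m) → (∀ m, N < m → w m = 0) →
        ∀ m, RL i (SA i w) (m + 1) ≤ RL i (SA i w) m := by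
      intro w hw0 hwa hwt
      have hwrec : ∀ m, SA i w m = w m - RA (i + 1) (SA i w) m - RL i (SA i w) m := fun m => by
        rw [(hSA i w hwt).2 m, aggregate_read_succ hRL hRA hKA]; ring
      exact antitone_young_drops (RO := RA (i + 1)) (Ry := RL i) (SO := SA (i + 1)) (Sy := SL i)
        (hRA (i + 1)) (hRL i) (hSA (i + 1)) (hSL i) hMONO hMONO2 hw0 hwa hwt (hSA i w hwt).1 hwrec
    -- (i) the carried ratios stay non-negative
    have hB : ∀ m k, i ≤ k → k ≤ n → 0 ≤ β i m k := by
      intro m k hk hkn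
      rcases Nat.lt_or_ge i k with hik | hik
      · rw [hβold i m k hi1 hik hkn]
        exact div_nonneg (hBN m k (by omega) hkn) (by linarith [hρ1 m])
      · have : k = i := by omega
        subst this
        rw [hβnew k m hi1 hin]
        exact div_nonneg (hρ0 m) (by linarith [hρ1 m])
    -- (ii) positivity and drop ratios for every admissible input
    have hmain : ∀ e : ℕ → ℝ, (∀ m, 0 ≤ e m) → (∀ m, e (m + 1) ≤ e m) → (∀ m, N < m → e m = 0) →
        (∀ m, 0 ≤ SA i e m) ∧ (∀ m k, i ≤ k → k ≤ n → RL k (SA i e) m ≤ β i m k * SA i e m) := by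
      intro e he0 hea het
      have hεrec : ∀ m, SA i e m = e m - RA (i + 1) (SA i e) m - RL i (SA i e) m := fun m => by
        rw [(hSA i e het).2 m, aggregate_read_succ hRL hRA hKA]; ring
      have hcomp := nonneg_of_age_composition_antitone (RO := RA (i + 1)) (Ry := RL i) (SO := SA (i + 1)) (Sy := SL i)
        (hRA (i + 1)) (hRL i) (hKL i) (hSA (i + 1)) (hSL i)
        (fun u hu0 hua hut => ⟨(hIH u hu0 hua hut).1, hKEY u hu0 hua hut, hMONO u hu0 hua hut⟩)
        he0 hea het (hSA i e het).1 hεrec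
      have hε0 : ∀ m, 0 ≤ SA i e m := fun m => (hcomp m).1
      have hsand := surplus_sandwich (RO := RA (i + 1)) (Ry := RL i) (SO := SA (i + 1)) (Sy := SL i)
        (A := fun w => (∀ m, 0 ≤ w m) ∧ ∀ m, w (m + 1) ≤ w m)
        (hRA (i + 1)) (hRL i) (hKL i) (hSA (i + 1)) (hSL i) het ⟨he0, hea⟩
        (fun u hu hut => ⟨(hIH u hu.1 hu.2 hut).1, hKEY u hu.1 hu.2 hut, hMONO u hu.1 hu.2 hut⟩)
        (hSA i e het).1 hεrec (ρ := ρ i) (hkey e he0 hea het)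
        ⟨fun m => read_nonneg (hRL i) (hKL i) (fun m' _ => hε0 m') , hMONO' e he0 hea het⟩
      obtain ⟨_, hDRv⟩ := hIH e he0 hea het
      refine ⟨hε0, fun m k hk hkn => ?_⟩
      have hle : ∀ m', SA i e m' ≤ SA (i + 1) e m' := fun m' => (hsand m').2
      have hlow : (1 - ρ i m) * SA (i + 1) e m ≤ SA i e m := (hsand m).1
      rcases Nat.lt_or_ge i k with hik | hik
      · rw [hβold i m k hi1 hik hkn]
        exact drop_ratio_step (D := fun u => RL k u m)
          (fun u u' hu0 huu' => read_le_read (hRL k) (hKL k) fun m' _ => huu' m')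
          hε0 hle hlow (hρ1 m) (hBN m k (by omega) hkn) (hDRv m k (by omega) hkn)
      · have : k = i := by omega
        subst this
        rw [hβnew k m hi1 hin]
        exact drop_ratio_step (D := fun u => RL k u m)
          (fun u u' hu0 huu' => read_le_read (hRL k) (hKL k) fun m' _ => huu' m')
          hε0 hle hlow (hρ1 m) (hρ0 m) (hkey e he0 hea het m)
    refine ⟨hB, hmain, fun j hj => ?_⟩
    -- (iii) (M1)_i by a downward induction in the pin, from (S-c) and the growth of the level-i surplus
    obtain ⟨he0, hea, het⟩ := truncation_admissible (N := N) hj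
    set e : ℕ → ℝ := fun m => if m ≤ j then (1:ℝ) else 0 with he
    obtain ⟨hε0, hDR⟩ := hmain e he0 hea het
    have hεt := (hSA i e het).1
    have hεj := hsupp i j hj
    have hKAi0 : ∀ m l, 0 ≤ KA i m l := fun m l => by
      rw [aggregate_eq_sum hKA hKAtop (by omega : i ≤ n + 1)]; exact sum_nonneg fun k _ => hKL k m l
    have hKAiN : ∀ m l, N ≤ l → KA i m l = 0 := fun m l hl => by
      rw [aggregate_eq_sum hKA hKAtop (by omega : i ≤ n + 1)]; exact sum_eq_zero fun k _ => hKLN k m l hl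
    -- growth of ε = SA i e from its own drop ratios, SHARP (entering lags below the edge credited); needs ε monotone deeper (downward IH)
    have hi' : i - 1 + 1 = i := by omega
    have hgrowε : ∀ m', (∀ p, m' + 1 ≤ p → p < j → SA i e p ≤ SA i e (p + 1)) → SA i e (m' + 1) ≤ HgS (i - 1) j m' * SA i e m' := by
      intro m' hmon
      -- monotone chains on [m'+1, j]
      have hchain : ∀ q a, m' + 1 ≤ a → a + q ≤ j → SA i e a ≤ SA i e (a + q) := by
        intro q
        induction q with
        | zero => intro a _ _; simp
        | succ q ihq => intro a ha hq; exact (ihq a ha (by omega)).trans (by rw [← add_assoc]; exact hmon (a + q) (by omega) (by omega))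
      have h := per_pin_growth_sharp hKL hKLN hKLy (fun k hk hkn => hy k (by omega) hkn) hRL hRA hKA hKAtop hθ0 hpers (i := i - 1) (by omega) hε0 hea
        (fun p => by rw [hi']; exact (hSA i e het).2 p) (m := m') (β := fun k => β i m' k) (fun k hk hkn => hDR m' k (by omega) hkn)
        (s := fun k => if m' + 1 + y k ≤ j then (1:ℝ) else 0) (fun k hk hkn => by
          split_ifs with hjk
          · rw [one_mul]; exact mul_le_mul_of_nonneg_left (hchain (y k) (m' + 1) le_rfl (by omega)) (hKL k _ _)
          · rw [zero_mul, zero_mul]; exact mul_nonneg (hKL k _ _) (hε0 _))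
      have hΩ := hΩ0 (i - 1) m' (by omega)
      have hden : 0 < 1 - ∑ k ∈ Ioc (i - 1) n, (KL k m' 0 - if m' + 1 + y k ≤ j then KL k (m' + 1) (y k - 1) else 0) := by
        have : ∑ k ∈ Ioc (i - 1) n, (KL k m' 0 - if m' + 1 + y k ≤ j then KL k (m' + 1) (y k - 1) else 0) ≤ ∑ k ∈ Ioc (i - 1) n, KL k m' 0 :=
          sum_le_sum fun k _ => by split_ifs <;> linarith [hKL k (m' + 1) (y k - 1)]
        linarith
      have e1 : ∀ k ∈ Ioc (i - 1) n, (KL k m' 0 - (if m' + 1 + y k ≤ j then (1:ℝ) else 0) * KL k (m' + 1) (y k - 1)) =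
          (KL k m' 0 - if m' + 1 + y k ≤ j then KL k (m' + 1) (y k - 1) else 0) := fun k _ => by split_ifs <;> ring
      rw [sum_congr rfl e1] at h
      rw [hHS, hi', div_mul_eq_mul_div, le_div_iff₀ hden]
      linarith
    -- downward induction in the pin
    suffices hdown : ∀ dd m, j ≤ m + dd → m < j → SA i e m ≤ SA i e (m + 1) from fun m hm => hdown j m (by omega) hm
    intro dd
    induction dd with
    | zero => intro m hm hmj; omega
    | succ dd ihd =>
      intro m hm hmj
      have hreads : (1:ℝ) * RA i (SA i e) (m + 1) ≤ RA i (SA i e) m :=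
        scaled_read_le_of_tail_sums_local (hRA i) hKAi0 hKAiN (hN1 (by omega)) le_rfl (v := SA i e) (j := j) (n := m) hε0 hεj
          (fun m' hm' hm'j => ihd m' (by omega) hm'j) (H := HgS (i - 1) j)
          (fun m' hm' _ => hgrowε m' fun p hp hpj => ihd p (by omega) hpj) zero_le_one
          (fun hjm L' hL' => by rw [one_mul]; exact hSc i m j hi1 hin hjm L' hL')
          (fun L hL hLN L' hL' => by rw [one_mul, ← hL]; exact hScp i m L hi1 hin hLN L' hL')
      rw [(hSA i e het).2 m, (hSA i e het).2 (m + 1)]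
      have e1 : e m = 1 := if_pos (by omega)
      have e2 : e (m + 1) = 1 := if_pos (by omega)
      rw [e1, e2]
      linarith

/-- **ROUTE (N), FIRST ORDER, END — MODULO STATIC FAMILIES ONLY, SHARP AGGREGATE FAMILY.**  As (E81h) `nonneg_of_static_families` with (S-c) replaced by
the edge-indexed (S-c♯). [folklore] -/
theorem nonneg_of_sharp_static_families
    (hKL : ∀ i m l, 0 ≤ KL i m l) (hKLN : ∀ i m l, N ≤ l → KL i m l = 0) (hKLy : ∀ i m l, y i ≤ l → KL i m l = 0)
    (hRL : ∀ i v m, RL i v m = ∑ l ∈ range N, KL i m l * v (m + 1 + l))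
    (hRA : ∀ i v m, RA i v m = ∑ l ∈ range N, KA i m l * v (m + 1 + l))
    (hKA : ∀ i m l, KA i m l = KL i m l + KA (i + 1) m l) (hKAtop : ∀ m l, KA (n + 1) m l = 0)
    (hSL : ∀ i (w : ℕ → ℝ), (∀ m, N < m → w m = 0) → (∀ m, N < m → SL i w m = 0) ∧ ∀ m, SL i w m = w m - RL i (SL i w) m)
    (hSA : ∀ i (w : ℕ → ℝ), (∀ m, N < m → w m = 0) → (∀ m, N < m → SA i w m = 0) ∧ ∀ m, SA i w m = w m - RA i (SA i w) m)
    (hy : ∀ i, 1 ≤ i → i ≤ n → 1 ≤ y i ∧ y i ≤ N)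
    (hθ0 : ∀ k m l, 0 ≤ θ k m l) (hpers : ∀ k m l i', (1 - θ k m l) * KL k m (i' + l) ≤ KL k (m + l) i')
    (hθmono : ∀ k m l l', l ≤ l' → θ k m l ≤ θ k m l')
    {ρ : ℕ → ℕ → ℝ} {β : ℕ → ℕ → ℕ → ℝ}
    (hρ : ∀ i m, 1 ≤ i → i ≤ n → ρ i m = (∑ l ∈ range N, KL i m l) * (1 + ∑ k ∈ Ioc i n, θ k m (y i) * β (i + 1) m k) /
      (1 - ∑ k ∈ Ioc i n, ∑ l ∈ range (y i), KL k m l))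
    (hβnew : ∀ i m, 1 ≤ i → i ≤ n → β i m i = ρ i m / (1 - ρ i m))
    (hβold : ∀ i m k, 1 ≤ i → i < k → k ≤ n → β i m k = β (i + 1) m k / (1 - ρ i m))
    (hΩ1 : ∀ i m, 1 ≤ i → i ≤ n → ∑ k ∈ Ioc i n, ∑ l ∈ range (y i), KL k m l < 1)
    (hclose : ∀ i m, 1 ≤ i → i ≤ n → ρ i m < 1)
    (hcumL : ∀ k, 1 ≤ k → k ≤ n → ∀ m L, ∑ l ∈ range (L + 1), KL k (m + 1) l ≤ ∑ l ∈ range (L + 2), KL k m l)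
    (hΩ0 : ∀ i m, i ≤ n → ∑ k ∈ Ioc i n, KL k m 0 < 1)
    {Hg : ℕ → ℕ → ℝ} (hH : ∀ i m, Hg i m = (1 + ∑ k ∈ Ioc i n, θ k m 1 * β (i + 1) m k) / (1 - ∑ k ∈ Ioc i n, KL k m 0))
    {M : ℕ → ℕ → ℝ} (hM : ∀ i m, M i m = KL i m 0 + ∑ l ∈ range (N - 1), max (KL i m (l + 1) - KL i (m + 1) l) 0)
    (hSb : ∀ i m, 1 ≤ i → i ≤ n → ∀ L', L' < y i →
      (1 + M i m) * ∑ l ∈ Ico L' (y i), Hg i (m + 1 + l) * KL i (m + 1) l ≤ ∑ l ∈ Ico L' (y i), KL i m l)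
    (hSbp : ∀ i m, 1 ≤ i → i ≤ n → ∀ L, L < y i → ∀ L', L' ≤ L →
      (1 + M i m) * ∑ l ∈ Ico L' L, Hg i (m + 1 + l) * KL i (m + 1) l ≤ ∑ l ∈ Ico L' (L + 1), KL i m l)
    {HgS : ℕ → ℕ → ℕ → ℝ} (hHS : ∀ i j m, HgS i j m = (1 + ∑ k ∈ Ioc i n, θ k m 1 * β (i + 1) m k) /
      (1 - ∑ k ∈ Ioc i n, (KL k m 0 - if m + 1 + y k ≤ j then KL k (m + 1) (y k - 1) else 0)))
    (hSc : ∀ i m j, 1 ≤ i → i ≤ n → m + 1 + N ≤ j → ∀ L', L' < N →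
      ∑ l ∈ Ico L' N, HgS (i - 1) j (m + 1 + l) * KA i (m + 1) l ≤ ∑ l ∈ Ico L' N, KA i m l)
    (hScp : ∀ i m L, 1 ≤ i → i ≤ n → L < N → ∀ L', L' ≤ L →
      ∑ l ∈ Ico L' L, HgS (i - 1) (m + 1 + L) (m + 1 + l) * KA i (m + 1) l ≤ ∑ l ∈ Ico L' (L + 1), KA i m l)
    {e ε : ℕ → ℝ} (he0 : ∀ m, 0 ≤ e m) (hea : ∀ m, e (m + 1) ≤ e m) (het : ∀ m, N < m → e m = 0)
    (hεt : ∀ m, N < m → ε m = 0) (hεrec : ∀ m, ε m = e m - RA 1 ε m) : ∀ m, 0 ≤ ε m := by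
  rcases Nat.eq_zero_or_pos n with hn0 | hn0
  · subst hn0; intro m; rw [hεrec m, hRA, sum_eq_zero fun l _ => by rw [hKAtop, zero_mul]]; linarith [he0 m]
  have h := (nonneg_and_drop_ratio_all_ages_sharp hKL hKLN hKLy hRL hRA hKA hKAtop hSL hSA hy hθ0 hpers hθmono hρ hβnew hβold hΩ1 hclose
    hcumL hΩ0 hH hM hSb hSbp hHS hSc hScp 1 le_rfl (by omega)).2.1 e he0 hea het
  have heq : ∀ m, ε m = SA 1 e m := sol_unique (hRA 1) hεt hεrec (hSA 1 e het).1 (hSA 1 e het).2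
  exact fun m => (heq m).symm ▸ h.1 m

end Summit.QuantumFields.BalabanUV.Beta.EriceRemainderEnclosureHistoryAutonomyComparisonAgeCompositionStaticEndSharp

end
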